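import Summits.MatrixMultiplication.OmegaCensus.ThreeSetZ5Z5Cover6S00S18
import Summits.MatrixMultiplication.OmegaCensus.ThreeSetZ5Z5Cover6S01S08
import Summits.MatrixMultiplication.OmegaCensus.ThreeSetZ5Z5Cover6S02S17
import Summits.MatrixMultiplication.OmegaCensus.ThreeSetZ5Z5Cover6S03S06
import Summits.MatrixMultiplication.OmegaCensus.ThreeSetZ5Z5Cover6S04S16
import Summits.MatrixMultiplication.OmegaCensus.ThreeSetZ5Z5Cover6S05S23
import Summits.MatrixMultiplication.OmegaCensus.ThreeSetZ5Z5Cover6S07S24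
import Summits.MatrixMultiplication.OmegaCensus.ThreeSetZ5Z5Cover6S09S15
import Summits.MatrixMultiplication.OmegaCensus.ThreeSetZ5Z5Cover6S10S13
import Summits.MatrixMultiplication.OmegaCensus.ThreeSetZ5Z5Cover6S11S14
import Summits.MatrixMultiplication.OmegaCensus.ThreeSetZ5Z5Cover6S12S22
import Summits.MatrixMultiplication.OmegaCensus.ThreeSetZ5Z5Cover6S19S20
import Summits.MatrixMultiplication.OmegaCensus.ThreeSetZ5Z5Cover6S21
import HarnessLib

/-!
# Three-set `ℤ₅ × ℤ₅` cover, parts `3` and `6`: every multiset of size `6` has a certified direction, for every hole position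

ω-census `pub-omega`, family (b3), seat pub-omega-group gen 36.  Framing: lottery ticket; floor = certified bounds/negative
ranges.  VALUE: finite kernel computations behind `ThreeSetZ5Z5Cells36.lean` (no cube symmetric form with `|W| = 3`, `|X| = 6`
over any odd-order `A ↠ ℤ₅ × ℤ₅`); NOT progress on ω.

**`exists_lineCert3At_six`**: for every hole position `σ < 25` and every `g : Fin 25 → ℕ` with `Σ g = 6` (a multiset of size `6` on
`ZMod 5 × ZMod 5`, coded by its values at the points `pt 5 i`) there are a direction `j ≤ 5` and a certificate list `certs` with
`lineCert3At 5 (vecFn (wvec j)) (vecFn (cnts 5 j g)) certs (pv 5 j σ) = true` — i.e. the three-set line datum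
(line image of `W = {0,e₁,e₂}`, line image of the multiset, hole value) in direction `j` carries a modular Farkas certificate.
Assembly of the 25 per-hole kernel computations (`ThreeSetZ5Z5Cover6S….lean`) through `exists_cert_of_cover3C` and
`lineCert3At_of_cert6`.
-/

namespace Summit.MatrixMultiplication.OmegaCensus

namespace Z5Z5ThreeSet

open ZpZpDomino

/-- The per-hole computations, indexed. [folklore] -/
theorem sound_cover6 (σ : ℕ) (hσ : σ < 25) :
    soundChk3 5 6 (tree6 σ) (cert6 σ) = true ∧ cover3C 5 6 (tree6 σ) = true := by
  have h : σ = 0 ∨ σ = 1 ∨ σ = 2 ∨ σ = 3 ∨ σ = 4 ∨ σ = 5 ∨ σ = 6 ∨ σ = 7 ∨ σ = 8 ∨ σ = 9 ∨ σ = 10 ∨ σ = 11 ∨ σ = 12 ∨ σ = 13 ∨ σ = 14 ∨ σ = 15 ∨ σ = 16 ∨ σ = 17 ∨ σ = 18 ∨ σ = 19 ∨ σ = 20 ∨ σ = 21 ∨ σ = 22 ∨ σ = 23 ∨ σ = 24 := by omega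
  rcases h with rfl | rfl | rfl | rfl | rfl | rfl | rfl | rfl | rfl | rfl | rfl | rfl | rfl | rfl | rfl | rfl | rfl | rfl | rfl | rfl | rfl | rfl | rfl | rfl | rfl
  · exact ⟨sound6_0, cover6_0⟩
  · exact ⟨sound6_1, cover6_1⟩
  · exact ⟨sound6_2, cover6_2⟩
  · exact ⟨sound6_3, cover6_3⟩
  · exact ⟨sound6_4, cover6_4⟩
  · exact ⟨sound6_5, cover6_5⟩
  · exact ⟨sound6_6, cover6_6⟩
  · exact ⟨sound6_7, cover6_7⟩
  · exact ⟨sound6_8, cover6_8⟩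
  · exact ⟨sound6_9, cover6_9⟩
  · exact ⟨sound6_10, cover6_10⟩
  · exact ⟨sound6_11, cover6_11⟩
  · exact ⟨sound6_12, cover6_12⟩
  · exact ⟨sound6_13, cover6_13⟩
  · exact ⟨sound6_14, cover6_14⟩
  · exact ⟨sound6_15, cover6_15⟩
  · exact ⟨sound6_16, cover6_16⟩
  · exact ⟨sound6_17, cover6_17⟩
  · exact ⟨sound6_18, cover6_18⟩
  · exact ⟨sound6_19, cover6_19⟩
  · exact ⟨sound6_20, cover6_20⟩
  · exact ⟨sound6_21, cover6_21⟩
  · exact ⟨sound6_22, cover6_22⟩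
  · exact ⟨sound6_23, cover6_23⟩
  · exact ⟨sound6_24, cover6_24⟩

/-- **Every multiset of size `6` on `ℤ₅²` has a certified direction, for every hole position `σ < 25`.** [folklore] -/
theorem exists_lineCert3At_six (σ : ℕ) (hσ : σ < 25) (g : Fin (5 * 5) → ℕ) (hg : ∑ i, g i = 6) :
    ∃ j < 6, ∃ certs : List (ℕ × List ℕ),
      lineCert3At 5 (vecFn (wvec j)) (vecFn (cnts 5 j g)) certs ((pv 5 j σ : ℕ) : ZMod 5) = true := by
  obtain ⟨hs, hc⟩ := sound_cover6 σ hσ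
  obtain ⟨j, hj, hcert⟩ := exists_cert_of_cover3C (tree6 σ) (cert6 σ) hs hc g hg
  exact ⟨j, hj, lineCert3At_of_cert6 hj hcert⟩

end Z5Z5ThreeSet

end Summit.MatrixMultiplication.OmegaCensus
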